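import Literature.NumberTheory.Connes2026.AnnulusCorrectionClosedForm
import Literature.NumberTheory.Connes2026.SemilocalCutoffScaleInvariance
import HarnessLib

/-!
# Connes 1999 Thm VII.4, `k = ℚ`, `S = {∞} ∪ P` — THE DIAGONAL SERIES OF THE ANNULUS CORRECTION AT `P = {p}`:
# every term is a diagonal coefficient of the ONE-PARAMETER FAMILY `P̂⁰_M Q₀(1) ϑ_{m log p}` along a transported
# Hilbert basis, and summability (hypothesis `hsum` of the DOOR) follows from a uniform trace-norm bound on it

LABEL (line 1): RH-FREE literature (theorems only; NO definition, NO named fact).  bears_on: LADDER-RH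
W-C/W-P (C1 named-fact debt), cell `rh-crit`, sub-cell cc, overflow row O1 — green layer under the row's last
named fact `Connes1999_thm_VII_4_rat` (the cases `P ≠ ∅`), ninth file of the "annulus road".  WHAT THIS IS
NOT: any claim about positivity, Weil's criterion or RH; nothing here bears on the truth of RH.

Sources.  A. Connes, Selecta Math. 5 (1999) [`Connes1999`], §VII proof of Thm 4, eqs. (29)–(33) (held text
`paper:arxiv-math_9811068`, p0013); M. Reed, B. Simon, *Methods of Modern Mathematical Physics I* (1972)
[`ReedSimon1972`], Thm. VI.24 (traces along orthonormal bases).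

## What is proved

Notation: `τ₀ = log p`, `ϑ_τ = scalingUnitary τ`, `P̂⁰_M = dualCutoffProj ∅ M`, `Q₀(Λ) = annulusProj p Λ`,
`K(Λ) = u_p^* P_Λ u_p − P_Λ`, `d_g(A, e) = diagCoeff g A e = ⟨e, ϑ(g) A e⟩`, and the one-parameter family
`Y_M(m) = P̂⁰_M Q₀(1) ϑ_{m τ₀}` (`M > 0`, `m ∈ ℤ`).

* §1 **`dualCutoffProj_mul_annulusTerm_eq_conj`** — for `Λ > 0`:
  `P̂⁰_Λ (ϑ_{aτ₀} Q₀(Λ) ϑ_{−bτ₀}) = ϑ_s Y_{Λ²p^a}(a − b) ϑ_{−s}`, `s = log Λ + aτ₀`; hence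
  **`diagCoeff_dualCutoffProj_annulusTerm`**: `d_g(P̂⁰_Λ ϑ_{aτ₀} Q₀(Λ) ϑ_{−bτ₀}, f_i) = d_g(Y_{Λ²p^a}(a−b), f^{(s)}_i)`
  along the transported Hilbert basis `f^{(s)} = f.scalingConj s` of `L²(ℝ)_ev`, and
  `diagCoeff_dualCutoffProj_annulusProj` (the case `a = b = 0`);
* §2 **`hasSum_diagCoeff_cutoffCorrection_singleton`** — for every `e`:
  `d_g(P̂⁰_Λ K(Λ), e) + d_g(P̂⁰_Λ Q₀(Λ), e) = Σ_{(a,b)} ((1 − p⁻¹) p^{−(a+b)/2}) · d_g(P̂⁰_Λ ϑ_{aτ₀} Q₀(Λ) ϑ_{−bτ₀}, e)`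
  (the closed-form expansion of `AnnulusCorrectionClosedForm` pushed through the continuous linear functional
  `A ↦ d_g(P̂⁰_Λ A, e)`);
* §3 **`summable_diagCoeff_cutoffCorrection_singleton_of_bound`** — if the diagonal series of `ϑ(g) Y_M(m)` along
  Hilbert bases of `L²(ℝ)_ev` are absolutely summable with a bound `C` uniform in `M`, `m` and the basis, then
  hypothesis `hsum` of the door `Connes1999_thm_VII_4_rat_at_of_annulusCorrection` holds at `P = {p}`:
  the diagonal series of `ϑ(g) P̂⁰_Λ K(Λ)` is summable along every Hilbert basis of `L²(ℝ)_ev`, every `Λ > 0`.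

No instance, notation or attribute; no `def`.
-/

noncomputable section

open _root_.MeasureTheory Complex Set Filter
open scoped Real Topology ComplexConjugate ENNReal InnerProductSpace

namespace Literature.NumberTheory.Connes2026

open Literature.NumberTheory.LFunctions Literature.Analysis.OperatorTheory
open Literature.NumberTheory.ConnesConsani
open Literature.NumberTheory.ConnesConsani2024
open Literature.NumberTheory.ConnesConsani2021 hiding cutoffProj cutoffProj_coeFn

variable (p : ℕ) [hp : Fact p.Prime]

/-! ## §1. Every term is a conjugate of the one-parameter family -/

section Conj

omit hp in
/-- `ϑ_{σ+τ} = ϑ_σ ϑ_τ` (as a product). [cite: ConnesConsani2021, §4 eq. (40) p. 15] -/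
private theorem scalingUnitary_add_mul (σ τ : ℝ) : scalingUnitary (σ + τ) = scalingUnitary σ * scalingUnitary τ :=
  scalingUnitary_add σ τ

omit hp in
/-- `Q₀(Λ) = ϑ_{log Λ} Q₀(1) ϑ_{−log Λ}` for `Λ > 0`. [cite: Connes1999, §V eqs. (15)–(16), §VII eq. (12) (arXiv p0013)] -/
theorem annulusProj_eq_conj {Λ : ℝ} (hΛ : 0 < Λ) :
    annulusProj p Λ = scalingUnitary (Real.log Λ) * annulusProj p 1 * scalingUnitary (-Real.log Λ) := by
  rw [annulusProj_def, annulusProj_def, cutoffProj_eq_conj Λ (Real.log Λ), cutoffProj_eq_conj (Λ / p) (Real.log Λ),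
    Real.exp_neg, Real.exp_log hΛ, mul_inv_cancel₀ hΛ.ne', div_mul_eq_mul_div, mul_inv_cancel₀ hΛ.ne', mul_sub,
    sub_mul]

/-- **`P̂⁰_Λ (ϑ_{aτ₀} Q₀(Λ) ϑ_{−bτ₀}) = ϑ_s (P̂⁰_{Λ²p^a} Q₀(1) ϑ_{(a−b)τ₀}) ϑ_{−s}`, `s = log Λ + aτ₀`** (`τ₀ = log p`,
`Λ > 0`): each term of the annulus expansion is unitarily conjugate to the one-parameter family with the fixed
annulus `Q₀(1)` and ultraviolet cutoff `Λ²p^a`. [cite: Connes1999, §VII proof of Thm 4 eqs. (29)–(33) (arXiv p0013)] -/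
theorem dualCutoffProj_mul_annulusTerm_eq_conj {Λ : ℝ} (hΛ : 0 < Λ) (a b : ℕ) :
    dualCutoffProj ∅ Λ *
        (scalingUnitary (a * Real.log p) * annulusProj p Λ * scalingUnitary (b * (-Real.log p))) =
      scalingUnitary (Real.log Λ + a * Real.log p) *
        (dualCutoffProj ∅ (Λ ^ 2 * (p : ℝ) ^ a) * annulusProj p 1 *
          scalingUnitary (((a : ℝ) - b) * Real.log p)) *
        scalingUnitary (-(Real.log Λ + a * Real.log p)) := by
  have hp0 : (0 : ℝ) < p := by exact_mod_cast hp.out.pos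
  have hexp : Real.exp (a * Real.log p) = (p : ℝ) ^ a := by rw [Real.exp_nat_mul, Real.exp_log hp0]
  have e1 : dualCutoffProj ∅ Λ * scalingUnitary (a * Real.log p) =
      scalingUnitary (a * Real.log p) * dualCutoffProj ∅ (Λ * (p : ℝ) ^ a) := by
    rw [dualCutoffProj_empty_mul_scalingUnitary, hexp]
  have e3 : dualCutoffProj ∅ (Λ * (p : ℝ) ^ a) =
      scalingUnitary (Real.log Λ) * dualCutoffProj ∅ (Λ ^ 2 * (p : ℝ) ^ a) * scalingUnitary (-Real.log Λ) := by
    rw [dualCutoffProj_empty_eq_conj (Λ * (p : ℝ) ^ a) (Real.log Λ), Real.exp_log hΛ]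
    congr 2
    ring
  have hA : scalingUnitary (a * Real.log p) * scalingUnitary (Real.log Λ) =
      scalingUnitary (Real.log Λ + a * Real.log p) := by
    rw [← scalingUnitary_add_mul, add_comm]
  have hB : scalingUnitary (-Real.log Λ) * scalingUnitary (b * (-Real.log p)) =
      scalingUnitary (((a : ℝ) - b) * Real.log p) * scalingUnitary (-(Real.log Λ + a * Real.log p)) := by
    rw [← scalingUnitary_add_mul, ← scalingUnitary_add_mul]
    congr 1
    ring
  calc dualCutoffProj ∅ Λ *
        (scalingUnitary (a * Real.log p) * annulusProj p Λ * scalingUnitary (b * (-Real.log p)))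
      = (dualCutoffProj ∅ Λ * scalingUnitary (a * Real.log p)) * annulusProj p Λ *
          scalingUnitary (b * (-Real.log p)) := by simp only [mul_assoc]
    _ = scalingUnitary (a * Real.log p) *
          (scalingUnitary (Real.log Λ) * dualCutoffProj ∅ (Λ ^ 2 * (p : ℝ) ^ a) * scalingUnitary (-Real.log Λ)) *
          (scalingUnitary (Real.log Λ) * annulusProj p 1 * scalingUnitary (-Real.log Λ)) *
          scalingUnitary (b * (-Real.log p)) := by rw [e1, e3, annulusProj_eq_conj p hΛ]
    _ = (scalingUnitary (a * Real.log p) * scalingUnitary (Real.log Λ)) * dualCutoffProj ∅ (Λ ^ 2 * (p : ℝ) ^ a) *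
          (scalingUnitary (-Real.log Λ) * scalingUnitary (Real.log Λ)) * annulusProj p 1 *
          (scalingUnitary (-Real.log Λ) * scalingUnitary (b * (-Real.log p))) := by simp only [mul_assoc]
    _ = scalingUnitary (Real.log Λ + a * Real.log p) *
          (dualCutoffProj ∅ (Λ ^ 2 * (p : ℝ) ^ a) * annulusProj p 1 *
            scalingUnitary (((a : ℝ) - b) * Real.log p)) *
          scalingUnitary (-(Real.log Λ + a * Real.log p)) := by
        rw [hA, scalingUnitary_neg_mul, mul_one, hB]; simp only [mul_assoc]

/-- **The diagonal coefficients of the terms are diagonal coefficients of the one-parameter family along a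
transported Hilbert basis**: `d_g(P̂⁰_Λ ϑ_{aτ₀} Q₀(Λ) ϑ_{−bτ₀}, f_i) = d_g(P̂⁰_{Λ²p^a} Q₀(1) ϑ_{(a−b)τ₀}, f^{(s)}_i)`,
`f^{(s)} = f.scalingConj (log Λ + aτ₀)`. [cite: Connes1999, §VII Thm 4 and proof eqs. (29)–(33) (arXiv p0013)] -/
theorem diagCoeff_dualCutoffProj_annulusTerm (g : ℝ → ℂ) {Λ : ℝ} (hΛ : 0 < Λ) (a b : ℕ) {ι : Type*}
    (f : HilbertBasis ι ℂ (evenPart : Submodule ℂ (Lp ℂ 2 (volume : Measure ℝ)))) (i : ι) :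
    diagCoeff g (dualCutoffProj ∅ Λ *
        (scalingUnitary (a * Real.log p) * annulusProj p Λ * scalingUnitary (b * (-Real.log p))))
        ((f i : evenPart) : Lp ℂ 2 (volume : Measure ℝ)) =
      diagCoeff g (dualCutoffProj ∅ (Λ ^ 2 * (p : ℝ) ^ a) * annulusProj p 1 *
          scalingUnitary (((a : ℝ) - b) * Real.log p))
        ((f.scalingConj (Real.log Λ + a * Real.log p) i : evenPart) : Lp ℂ 2 (volume : Measure ℝ)) := by
  rw [dualCutoffProj_mul_annulusTerm_eq_conj p hΛ, diagCoeff_conj_scalingUnitary]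

/-- The case `a = b = 0`: `d_g(P̂⁰_Λ Q₀(Λ), f_i) = d_g(P̂⁰_{Λ²} Q₀(1) ϑ_0, f^{(log Λ)}_i)`. [cite: Connes1999, §VII Thm 4 and proof eqs. (29)–(33) (arXiv p0013)] -/
theorem diagCoeff_dualCutoffProj_annulusProj (g : ℝ → ℂ) {Λ : ℝ} (hΛ : 0 < Λ) {ι : Type*}
    (f : HilbertBasis ι ℂ (evenPart : Submodule ℂ (Lp ℂ 2 (volume : Measure ℝ)))) (i : ι) :
    diagCoeff g (dualCutoffProj ∅ Λ * annulusProj p Λ) ((f i : evenPart) : Lp ℂ 2 (volume : Measure ℝ)) =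
      diagCoeff g (dualCutoffProj ∅ (Λ ^ 2) * annulusProj p 1 * scalingUnitary ((0 : ℤ) * Real.log p))
        ((f.scalingConj (Real.log Λ) i : evenPart) : Lp ℂ 2 (volume : Measure ℝ)) := by
  have h := diagCoeff_dualCutoffProj_annulusTerm p g hΛ 0 0 f i
  simp only [Nat.cast_zero, zero_mul, scalingUnitary_zero, one_mul, mul_one, pow_zero, add_zero, sub_zero,
    Int.cast_zero] at h ⊢
  exact h

end Conj

/-! ## §2. The diagonal series of `K(Λ)` expanded -/

section Expansion

/-- The continuous linear functional `A ↦ d_g(P̂⁰_Λ A, e) = ⟨e, ϑ(g) P̂⁰_Λ A e⟩` on `L(L²(ℝ))` (evaluation at `e`,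
then `ϑ(g) P̂⁰_Λ`, then `⟨e, ·⟩`). [cite: Connes1999, §VII Thm 4 (arXiv p0013:L1)] -/
theorem diagCoeff_dualCutoffProj_mul_eq_clm (g : ℝ → ℂ) (Λ : ℝ) (e : Lp ℂ 2 (volume : Measure ℝ))
    (A : Lp ℂ 2 (volume : Measure ℝ) →L[ℂ] Lp ℂ 2 (volume : Measure ℝ)) :
    diagCoeff g (dualCutoffProj ∅ Λ * A) e =
      ((innerSL ℂ e).comp ((scalingOp g ∘L dualCutoffProj ∅ Λ).comp
        (ContinuousLinearMap.apply ℂ (Lp ℂ 2 (volume : Measure ℝ)) e))) A := by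
  rw [diagCoeff, mul_apply_eq_comp]
  rfl

/-- **The diagonal coefficients of `P̂⁰_Λ K(Λ)` expanded**: for every `e ∈ L²(ℝ)`,
`d_g(P̂⁰_Λ K(Λ), e) + d_g(P̂⁰_Λ Q₀(Λ), e) = Σ_{(a,b) ∈ ℕ²} ((1 − p⁻¹) p^{−(a+b)/2}) d_g(P̂⁰_Λ ϑ_{aτ₀} Q₀(Λ) ϑ_{−bτ₀}, e)`
(absolutely convergent). [cite: Connes1999, §VII proof of Thm 4 eqs. (29)–(33) (arXiv p0013)] -/
theorem hasSum_diagCoeff_cutoffCorrection_singleton (g : ℝ → ℂ) (Λ : ℝ) (e : Lp ℂ 2 (volume : Measure ℝ)) :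
    HasSum (fun ab : ℕ × ℕ =>
        ((1 - (p : ℂ)⁻¹) * (((Real.sqrt p)⁻¹ : ℝ) : ℂ) ^ (ab.1 + ab.2)) *
          diagCoeff g (dualCutoffProj ∅ Λ *
            (scalingUnitary (ab.1 * Real.log p) * annulusProj p Λ * scalingUnitary (ab.2 * (-Real.log p)))) e)
      (diagCoeff g (dualCutoffProj ∅ Λ *
          (ContinuousLinearMap.adjoint (twistUnitary {p}) * cutoffProj Λ * twistUnitary {p} - cutoffProj Λ)) e +
        diagCoeff g (dualCutoffProj ∅ Λ * annulusProj p Λ) e) := by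
  set φ := (innerSL ℂ e).comp ((scalingOp g ∘L dualCutoffProj ∅ Λ).comp
    (ContinuousLinearMap.apply ℂ (Lp ℂ 2 (volume : Measure ℝ)) e)) with hφ
  have h := ContinuousLinearMap.hasSum φ (hasSum_cutoffCorrection_singleton p Λ)
  have hφ' : ∀ A, φ A = diagCoeff g (dualCutoffProj ∅ Λ * A) e := fun A =>
    (diagCoeff_dualCutoffProj_mul_eq_clm g Λ e A).symm
  rw [map_add, hφ', hφ'] at h
  refine h.congr_fun fun ab => ?_
  change _ = φ (_ • _)
  rw [map_smul, smul_eq_mul, hφ']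

end Expansion

/-! ## §3. Summability of the diagonal series from a uniform bound on the one-parameter family -/

section Summability

/-- **Hypothesis `hsum` of the door at `P = {p}` from a uniform trace-norm bound on the one-parameter family.**
Suppose there is `C` such that for every `M`, every `m ∈ ℤ` and every Hilbert basis `(f_i)` of `L²(ℝ)_ev` the
diagonal series of `ϑ(g) P̂⁰_M Q₀(1) ϑ_{mτ₀}` is absolutely summable with `Σ_i |d_g(P̂⁰_M Q₀(1) ϑ_{mτ₀}, f_i)| ≤ C`.
Then for every Hilbert basis `(f_i)` of `L²(ℝ)_ev` and every `Λ > 0` the diagonal series of `ϑ(g) P̂⁰_Λ K(Λ)`,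
`K(Λ) = u_p^* P_Λ u_p − P_Λ`, is summable — by §1–§2 it is `Σ_{(a,b)} w_{ab} d_g(Y_{Λ²p^a}(a−b), f^{(s_a)}_i) − d_g(Y_{Λ²}(0), f^{(log Λ)}_i)`
with `Σ_{(a,b)} |w_{ab}| C < ∞`. [cite: Connes1999, §VII Thm 4 and proof eqs. (29)–(33) (arXiv p0013); ReedSimon1972, Thm. VI.24, PDF p. 199] -/
theorem summable_diagCoeff_cutoffCorrection_singleton_of_bound (g : ℝ → ℂ) {C : ℝ}
    (hW1 : ∀ (M : ℝ) (m : ℤ) (ι : Type)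
      (f : HilbertBasis ι ℂ (evenPart : Submodule ℂ (Lp ℂ 2 (volume : Measure ℝ)))),
      Summable (fun i => ‖diagCoeff g (dualCutoffProj ∅ M * annulusProj p 1 * scalingUnitary (m * Real.log p))
        ((f i : evenPart) : Lp ℂ 2 (volume : Measure ℝ))‖) ∧
      ∑' i, ‖diagCoeff g (dualCutoffProj ∅ M * annulusProj p 1 * scalingUnitary (m * Real.log p))
        ((f i : evenPart) : Lp ℂ 2 (volume : Measure ℝ))‖ ≤ C)
    (ι : Type) (f : HilbertBasis ι ℂ (evenPart : Submodule ℂ (Lp ℂ 2 (volume : Measure ℝ))))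
    {Λ : ℝ} (hΛ : 0 < Λ) :
    Summable fun i => diagCoeff g (dualCutoffProj ∅ Λ *
        (ContinuousLinearMap.adjoint (twistUnitary {p}) * cutoffProj Λ * twistUnitary {p} - cutoffProj Λ))
      ((f i : evenPart) : Lp ℂ 2 (volume : Measure ℝ)) := by
  have hp0 : (0 : ℝ) < p := by exact_mod_cast hp.out.pos
  have hC : 0 ≤ C := by
    obtain ⟨h1, h2⟩ := hW1 1 0 ι f
    exact (tsum_nonneg fun _ => norm_nonneg _).trans h2
  -- the weights and their absolute summability
  set r : ℝ := (Real.sqrt p)⁻¹ with hr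
  have hr0 : 0 ≤ r := inv_nonneg.mpr (Real.sqrt_nonneg _)
  have hr1 : r < 1 := by
    rw [hr, inv_lt_one_iff₀]; right
    rw [show (1 : ℝ) = Real.sqrt 1 by simp]
    exact Real.sqrt_lt_sqrt zero_le_one (by exact_mod_cast hp.out.one_lt)
  set w : ℕ × ℕ → ℂ := fun ab => (1 - (p : ℂ)⁻¹) * ((r : ℝ) : ℂ) ^ (ab.1 + ab.2) with hw
  have hwn : ∀ ab : ℕ × ℕ, ‖w ab‖ ≤ 2 * (r ^ ab.1 * r ^ ab.2) := fun ab => by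
    rw [hw]
    simp only
    rw [norm_mul, norm_pow, Complex.norm_real, Real.norm_eq_abs, abs_of_nonneg hr0, pow_add]
    refine mul_le_mul_of_nonneg_right ?_ (mul_nonneg (pow_nonneg hr0 _) (pow_nonneg hr0 _))
    calc ‖(1 : ℂ) - (p : ℂ)⁻¹‖ ≤ ‖(1 : ℂ)‖ + ‖(p : ℂ)⁻¹‖ := norm_sub_le _ _
      _ ≤ 1 + 1 := by
          rw [norm_one, norm_inv, Complex.norm_natCast]
          gcongr
          exact inv_le_one_of_one_le₀ (by exact_mod_cast hp.out.one_lt.le)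
      _ = 2 := by norm_num
  have hwsum : Summable fun ab : ℕ × ℕ => 2 * (r ^ ab.1 * r ^ ab.2) :=
    ((summable_geometric_of_lt_one hr0 hr1).mul_of_nonneg (summable_geometric_of_lt_one hr0 hr1)
      (fun _ => pow_nonneg hr0 _) (fun _ => pow_nonneg hr0 _)).mul_left 2
  -- the terms `D ab i` and their identification with the one-parameter family
  set D : ℕ × ℕ → ι → ℂ := fun ab i => diagCoeff g (dualCutoffProj ∅ Λ *
    (scalingUnitary (ab.1 * Real.log p) * annulusProj p Λ * scalingUnitary (ab.2 * (-Real.log p))))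
    ((f i : evenPart) : Lp ℂ 2 (volume : Measure ℝ)) with hD
  have hDrow : ∀ ab : ℕ × ℕ, Summable (fun i => ‖D ab i‖) ∧ ∑' i, ‖D ab i‖ ≤ C := fun ab => by
    have h := hW1 (Λ ^ 2 * (p : ℝ) ^ ab.1) ((ab.1 : ℤ) - ab.2) ι (f.scalingConj (Real.log Λ + ab.1 * Real.log p))
    have hcast : (((ab.1 : ℤ) - ab.2 : ℤ) : ℝ) = (ab.1 : ℝ) - ab.2 := by push_cast; ring
    rw [hcast] at h
    simp_rw [hD, diagCoeff_dualCutoffProj_annulusTerm p g hΛ] 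
    exact h
  -- joint absolute summability over `(ℕ × ℕ) × ι`
  have hG : Summable fun abi : (ℕ × ℕ) × ι => ‖w abi.1‖ * ‖D abi.1 abi.2‖ := by
    refine (summable_prod_of_nonneg fun _ => mul_nonneg (norm_nonneg _) (norm_nonneg _)).2 ⟨fun ab => ?_, ?_⟩
    · exact ((hDrow ab).1.mul_left ‖w ab‖).congr fun i => rfl
    · refine Summable.of_nonneg_of_le (fun _ => tsum_nonneg fun _ => mul_nonneg (norm_nonneg _) (norm_nonneg _))
        (fun ab => ?_) (hwsum.mul_right C)
      simp only
      rw [tsum_mul_left]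
      exact mul_le_mul (hwn ab) (hDrow ab).2 (tsum_nonneg fun _ => norm_nonneg _)
        (mul_nonneg zero_le_two (mul_nonneg (pow_nonneg hr0 _) (pow_nonneg hr0 _)))
  have hG' : Summable fun iab : ι × (ℕ × ℕ) => ‖w iab.2‖ * ‖D iab.2 iab.1‖ :=
    (Equiv.prodComm ι (ℕ × ℕ)).summable_iff.mpr hG
  -- hence the `(a,b)`-series is summable in `i`
  have hrowi : ∀ i, Summable fun ab : ℕ × ℕ => ‖w ab‖ * ‖D ab i‖ := fun i =>
    ((summable_prod_of_nonneg fun _ => mul_nonneg (norm_nonneg _) (norm_nonneg _)).1 hG').1 i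
  have hSi : Summable fun i => ∑' ab : ℕ × ℕ, ‖w ab‖ * ‖D ab i‖ :=
    ((summable_prod_of_nonneg fun _ => mul_nonneg (norm_nonneg _) (norm_nonneg _)).1 hG').2
  have hmain : Summable fun i => ∑' ab : ℕ × ℕ, w ab * D ab i := by
    refine Summable.of_norm_bounded hSi fun i => ?_
    refine (norm_tsum_le_tsum_norm ((hrowi i).congr fun ab => (norm_mul _ _).symm)).trans (le_of_eq ?_)
    exact tsum_congr fun ab => norm_mul _ _
  -- the `Q₀(Λ)` term
  have hQ : Summable fun i => diagCoeff g (dualCutoffProj ∅ Λ * annulusProj p Λ)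
      ((f i : evenPart) : Lp ℂ 2 (volume : Measure ℝ)) := by
    have h := (hW1 (Λ ^ 2) 0 ι (f.scalingConj (Real.log Λ))).1
    refine (Summable.of_norm h).congr fun i => ?_
    rw [diagCoeff_dualCutoffProj_annulusProj p g hΛ f i]
  -- assemble: `d(P̂ K) = Σ_ab w D − d(P̂ Q₀)`
  refine (hmain.sub hQ).congr fun i => ?_
  have h := (hasSum_diagCoeff_cutoffCorrection_singleton p g Λ ((f i : evenPart) : Lp ℂ 2 (volume : Measure ℝ))).tsum_eq
  simp only [hw, hD] at h ⊢
  rw [h, add_sub_cancel_right]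

end Summability

end Literature.NumberTheory.Connes2026
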